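import Mathlib
import HarnessLib

/-!
# `NoHeavyLowerTail` (crux stmt-CriticalPhenomena-4575), antithetic vdBHK programme: the POLAR GLUING LEMMA for antipodal-Kleitman structures

Support file (seat `prim-ineq-gen-7` gen 18; `--supports stmt-CriticalPhenomena-4575`).  Nothing is asserted about the crux; no `sorry`,
no new definitions (the AK summand `1_A(u)(1_B(u) − 1_B(ι u))` is written out).
Memo: run/shared/lean/prim/prim-ineq-gen-7/FINDING-BUNKBED-CUBES-g18.md §3a.

SETTING.  A finite preorder `P` with an order-reversing involution `ι`.  A finite set `Q ⊆ P` is *antipodal Kleitman* (AK, up-set form,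
counting weight) if `Σ_{u ∈ Q} 1_A(u) (1_B(u) − 1_B(ι u)) ≥ 0` for all up-sets `A, B` of `P`, i.e. `#(A ∩ B ∩ Q) ≥ #(A ∩ ι⁻¹B ∩ Q)`; for
`Q = Ω_T` (the two-sided frame of a 2-coloured graph with the doubled order) this is MASTER⁺ = the antithetic form of
van den Berg–Häggström–Kahn's Theorem 2.1.  The block calculus of gen 17 (products, ι-invariant PARTITIONS into AK blocks, comparable pairs,
diamonds; file `…KnQuestion8AntitheticProduct`) proves MASTER⁺ for trees and theta graphs but provably stops at the 5-edge multigraph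
`x =e₁e₂= b – c =g₁g₂= t` (memo §2d: its 14-state frame poset has no ι-invariant partition into AK blocks).  That poset is the UNION of two
Boolean cubes `Q₁ ∪ Q₂` meeting in an incomparable antipodal pair `{a, ι a}` with `a` a co-atom of `Q₁` and an atom of `Q₂`.  The theorem below
(T7 of the memo) is the first tool for OVERLAPPING blocks:

THEOREM (`polarGluing`).  If `Q₁, Q₂` are AK, `Q₁ ∩ Q₂ = {a, ι a}`, `a` and `ι a` are incomparable, every element of `Q₂` is `≥ a` or
`≤ ι a`, and every element of `Q₁` is `≥ ι a` or `≤ a`, then `Q₁ ∪ Q₂` is AK.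
Proof: inclusion–exclusion `Σ_{Q₁∪Q₂} = Σ_{Q₁} + Σ_{Q₂} − Σ_{Q₁∩Q₂}`; the correction is `(1_A(a) − 1_A(ιa))(1_B(a) − 1_B(ιa)) ≤ 1`, and when
it equals `1` the polar hypothesis pins `A ∩ Q₂ = B ∩ Q₂ = ↑a` (resp. `A ∩ Q₁ = B ∩ Q₁ = ↑ιa`), on which the summand is identically `1`,
so `Σ_{Q₂} ≥ 1` (resp. `Σ_{Q₁} ≥ 1`).  COROLLARY (memo §3b, pencil): MASTER⁺ for `x =(k)= b – c =(l)= t`, all `k, l ≥ 1` — the first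
MASTER⁺ theorem for a graph whose frame poset admits no block/product decomposition.
-/

namespace Summit.CriticalPhenomena.PercolationContinuityZ3.Theorems

open Finset

namespace AntitheticGluing

variable {P : Type*} [Preorder P] [DecidableEq P]

omit [Preorder P] in
/-- The correction term of the inclusion–exclusion: on the antipodal pair `{a, ι a}` the AK summands add up to
`(1_A(a) − 1_A(ιa)) · (1_B(a) − 1_B(ιa))`. [this work] -/
theorem akTerm_pair (ι : P → P) (a : P) (hι : ι (ι a) = a) (A B : Finset P) :
    ((if a ∈ A then (1:ℤ) else 0) * ((if a ∈ B then (1:ℤ) else 0) - (if ι a ∈ B then (1:ℤ) else 0))) + ((if (ι a) ∈ A then (1:ℤ) else 0) * ((if (ι a) ∈ B then (1:ℤ) else 0) - (if ι (ι a) ∈ B then (1:ℤ) else 0))) =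
      ((if a ∈ A then (1:ℤ) else 0) - (if ι a ∈ A then 1 else 0)) *
        ((if a ∈ B then (1:ℤ) else 0) - (if ι a ∈ B then 1 else 0)) := by
  rw [hι]
  ring

/-- **Polar gluing lemma (T7).**  Let `ι` be an order-reversing involution of a preorder, `Q₁, Q₂` finite sets that are antipodal
Kleitman in the up-set / counting form (for all up-sets `A, B`: `Σ_{u ∈ Qᵢ} 1_A(u)(1_B(u) − 1_B(ι u)) ≥ 0`), with `Q₁ ∩ Q₂ = {a, ι a}`,
`a ∥ ι a`, `Q₂ ⊆ ↑a ∪ ↓(ι a)` and `Q₁ ⊆ ↑(ι a) ∪ ↓a`.  Then `Q₁ ∪ Q₂` is antipodal Kleitman.  [this work; memo §3a] -/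
theorem polarGluing (ι : P → P) (hι : ∀ u, ι (ι u) = u) (hanti : ∀ u v, u ≤ v → ι v ≤ ι u)
    (Q₁ Q₂ : Finset P) (a : P) (hinter : Q₁ ∩ Q₂ = {a, ι a})
    (hna : ¬ a ≤ ι a) (hna' : ¬ ι a ≤ a)
    (hpol₂ : ∀ u ∈ Q₂, a ≤ u ∨ u ≤ ι a) (hpol₁ : ∀ u ∈ Q₁, ι a ≤ u ∨ u ≤ a)
    (h₁ : ∀ A B : Finset P, (∀ u v, u ≤ v → u ∈ A → v ∈ A) → (∀ u v, u ≤ v → u ∈ B → v ∈ B) →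
      0 ≤ ∑ u ∈ Q₁, ((if u ∈ A then (1:ℤ) else 0) * ((if u ∈ B then (1:ℤ) else 0) - (if ι u ∈ B then (1:ℤ) else 0))))
    (h₂ : ∀ A B : Finset P, (∀ u v, u ≤ v → u ∈ A → v ∈ A) → (∀ u v, u ≤ v → u ∈ B → v ∈ B) →
      0 ≤ ∑ u ∈ Q₂, ((if u ∈ A then (1:ℤ) else 0) * ((if u ∈ B then (1:ℤ) else 0) - (if ι u ∈ B then (1:ℤ) else 0))))
    (A B : Finset P) (hA : ∀ u v, u ≤ v → u ∈ A → v ∈ A) (hB : ∀ u v, u ≤ v → u ∈ B → v ∈ B) :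
    0 ≤ ∑ u ∈ Q₁ ∪ Q₂, ((if u ∈ A then (1:ℤ) else 0) * ((if u ∈ B then (1:ℤ) else 0) - (if ι u ∈ B then (1:ℤ) else 0))) := by
  have ha_ne : a ≠ ι a := fun h => hna (h ▸ le_rfl)
  have haQ₂ : a ∈ Q₂ := by
    have : a ∈ Q₁ ∩ Q₂ := by rw [hinter]; simp
    exact (Finset.mem_inter.1 this).2
  have hιaQ₁ : ι a ∈ Q₁ := by
    have : ι a ∈ Q₁ ∩ Q₂ := by rw [hinter]; simp
    exact (Finset.mem_inter.1 this).1
  -- inclusion–exclusion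
  have hIE : (∑ u ∈ Q₁ ∪ Q₂, ((if u ∈ A then (1:ℤ) else 0) * ((if u ∈ B then (1:ℤ) else 0) - (if ι u ∈ B then (1:ℤ) else 0)))) =
      (∑ u ∈ Q₁, ((if u ∈ A then (1:ℤ) else 0) * ((if u ∈ B then (1:ℤ) else 0) - (if ι u ∈ B then (1:ℤ) else 0)))) + (∑ u ∈ Q₂, ((if u ∈ A then (1:ℤ) else 0) * ((if u ∈ B then (1:ℤ) else 0) - (if ι u ∈ B then (1:ℤ) else 0)))) - (((if a ∈ A then (1:ℤ) else 0) * ((if a ∈ B then (1:ℤ) else 0) - (if ι a ∈ B then (1:ℤ) else 0))) + ((if (ι a) ∈ A then (1:ℤ) else 0) * ((if (ι a) ∈ B then (1:ℤ) else 0) - (if ι (ι a) ∈ B then (1:ℤ) else 0)))) := by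
    have h := Finset.sum_union_inter (s₁ := Q₁) (s₂ := Q₂) (f := fun u => ((if u ∈ A then (1:ℤ) else 0) * ((if u ∈ B then (1:ℤ) else 0) - (if ι u ∈ B then (1:ℤ) else 0))))
    rw [hinter, Finset.sum_pair ha_ne] at h
    linarith
  have hΔ₁ := h₁ A B hA hB
  have hΔ₂ := h₂ A B hA hB
  rw [hIE, akTerm_pair ι a (hι a) A B]
  by_cases haA : a ∈ A <;> by_cases hiA : ι a ∈ A <;> by_cases haB : a ∈ B <;> by_cases hiB : ι a ∈ B <;>
    simp only [haA, hiA, haB, hiB, if_true, if_false] <;> try linarith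
  · -- bad case 1: a ∈ A, ι a ∉ A, a ∈ B, ι a ∉ B: the correction is 1; show Σ_{Q₂} ≥ 1.
    have hterm : ∀ u ∈ Q₂, (if u = a then (1:ℤ) else 0) ≤ ((if u ∈ A then (1:ℤ) else 0) * ((if u ∈ B then (1:ℤ) else 0) - (if ι u ∈ B then (1:ℤ) else 0))) := by
      intro u hu
      rcases hpol₂ u hu with h | h
      · -- a ≤ u: u ∈ A, u ∈ B, ι u ∉ B
        have huA : u ∈ A := hA a u h haA
        have huB : u ∈ B := hB a u h haB
        have hιu : ι u ∉ B := fun hh => hiB (hB (ι u) (ι a) (hanti a u h) hh)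
        simp only [huA, huB, hιu, if_true, if_false]
        split_ifs <;> norm_num
      · -- u ≤ ι a: u ∉ A, and u ≠ a
        have huA : u ∉ A := fun hh => hiA (hA u (ι a) h hh)
        have hune : u ≠ a := fun hh => hna (hh ▸ h)
        simp [huA, hune]
    have hsum : (∑ u ∈ Q₂, (if u = a then (1:ℤ) else 0)) ≤ ∑ u ∈ Q₂, ((if u ∈ A then (1:ℤ) else 0) * ((if u ∈ B then (1:ℤ) else 0) - (if ι u ∈ B then (1:ℤ) else 0))) :=
      Finset.sum_le_sum hterm
    rw [Finset.sum_ite_eq' Q₂ a, if_pos haQ₂] at hsum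
    linarith
  · -- bad case 2: ι a ∈ A, a ∉ A, ι a ∈ B, a ∉ B: show Σ_{Q₁} ≥ 1.
    have hterm : ∀ u ∈ Q₁, (if u = ι a then (1:ℤ) else 0) ≤ ((if u ∈ A then (1:ℤ) else 0) * ((if u ∈ B then (1:ℤ) else 0) - (if ι u ∈ B then (1:ℤ) else 0))) := by
      intro u hu
      rcases hpol₁ u hu with h | h
      · -- ι a ≤ u: u ∈ A, u ∈ B, ι u ≤ a hence ι u ∉ B
        have huA : u ∈ A := hA (ι a) u h hiA
        have huB : u ∈ B := hB (ι a) u h hiB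
        have hle : ι u ≤ a := by have := hanti (ι a) u h; rwa [hι] at this
        have hιu : ι u ∉ B := fun hh => haB (hB (ι u) a hle hh)
        simp only [huA, huB, hιu, if_true, if_false]
        split_ifs <;> norm_num
      · -- u ≤ a: u ∉ A, and u ≠ ι a
        have huA : u ∉ A := fun hh => haA (hA u a h hh)
        have hune : u ≠ ι a := fun hh => hna' (hh ▸ h)
        simp [huA, hune]
    have hsum : (∑ u ∈ Q₁, (if u = ι a then (1:ℤ) else 0)) ≤ ∑ u ∈ Q₁, ((if u ∈ A then (1:ℤ) else 0) * ((if u ∈ B then (1:ℤ) else 0) - (if ι u ∈ B then (1:ℤ) else 0))) :=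
      Finset.sum_le_sum hterm
    rw [Finset.sum_ite_eq' Q₁ (ι a), if_pos hιaQ₁] at hsum
    linarith

end AntitheticGluing

end Summit.CriticalPhenomena.PercolationContinuityZ3.Theorems
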